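import Literature.AlgebraicGeometry.ShimuraVarieties.RapoportSmithlingZhang2020.Sec7LFunctionsRTF      -- `Sec7Data` and its §7 vocabulary (`J₀`, `dJ`, `dJv`, `IsGaussian`, `AreSmoothTransfers`, …)
import Literature.AlgebraicGeometry.ShimuraVarieties.RapoportSmithlingZhang2020.Sec2GroupTheoreticSetup -- ★ `blockDiagGL` (`h ↦ diag(h, 1)`, = ★ `Sec2Datum.inclHG`) for (8.13)
import HarnessLib

/-!
# Rapoport–Smithling–Zhang 2020, §8 «The conjectures for the arithmetic intersection pairing» (v6 pp. 43–54) —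
# as a LETTER continuing the §7 letter: one posited datum `Sec8Data` extending `Sec7Data`, the printed
# definitions ((8.1)–(8.7), (8.12)–(8.16), (8.18)–(8.19), Def. 8.4) as `def`s with bodies, the PROVED printed
# statements (Thm. 8.5, Lemma 8.7, Lemma 8.11, Prop. 8.12, Thms. 8.14, 8.15, Lemma 8.16, Thm. 8.19) as relations,
# and the three statements the source ASSERTS WITHOUT PROOF (its 8.2, 8.8, 8.13) as PREDICATES ON THEIR DATA only

M. Rapoport, B. Smithling, W. Zhang, *Arithmetic diagonal cycles on unitary Shimura varieties*, Compositio Math.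
**156** (2020) 1745–1824 = arXiv:1710.06962 **v6** [RapoportSmithlingZhang2020Diagonal], §8.  Source text of
record (squad TKR sheet §A, lit1 kit): `run/shared/lean/pub/hodgecm-mathlib/F0/P6/lit1/RSZ2020-v6-pages.txt`,
blocks «arXiv v6 page N», pp. 43–54, with the item map `RSZ2020-v6-itemmap.lit1-g5.md` (15cc0883): Rem. 8.1,
Conj. 8.2, (8.1)–(8.5) p. 44 · Rem. 8.3, §8.2, (8.6)–(8.7), Def. 8.4, Thm. 8.5 p. 45 · Rem. 8.6, Lemma 8.7 p. 46 ·
(8.8)–(8.11) pp. 47–48 · (8.12), Conj. 8.8, Rem. 8.9–8.10, Lemma 8.11 p. 48 · (8.13)–(8.15), Prop. 8.12 p. 49 ·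
§8.3, (8.16)–(8.19), Conj. 8.13 p. 50 · Thms. 8.14–8.15, (8.20)–(8.22) p. 51 · (8.23)–(8.29) p. 52 · Lemma 8.16,
Rem. 8.17 p. 53 · Rem. 8.18, Thm. 8.19, (8.30), Rem. 8.20 p. 54.  Pins «p. N» = v6 page.  Signs and sub/superscripts
lost in the page text (`−`, `♮`, `^∘`) were read off the held arXiv TeX text `paper:arxiv-1710.06962` (chunks 34–40).
Squad TKR (HCML «GO 500»), typer TKR-t06 (= TK-t01); target
`Literature/AlgebraicGeometry/ShimuraVarieties/RapoportSmithlingZhang2020/Sec8ArithmeticIntersectionPairing.lean`,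
namespace `Literature.AlgebraicGeometry.ShimuraVarieties.RapoportSmithlingZhang2020.Sec8ArithmeticIntersectionPairing`.
STATEMENTS ONLY (cell TYPER LINT RULE): no theorem, no proof, no `sorry`, no `axiom`, no `instance`, no `notation`.

## The three unproved statements of §8 (its 8.2, 8.8, 8.13) are NOT Literature facts

The source states 8.2 «Global conj., trivial level structure» (p. 44), 8.8 «Global conj., nontrivial level
structure» (p. 48) and 8.13 «Semi-global conj.» (pp. 50–51) WITHOUT proof; a Literature named fact must cite a
source that proves it, so none of the three is typed as a closed `Prop` here.  Because the PROVED Theorems 8.14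
(«8.13 for all places `v₀` implies 8.8»), 8.15 («8.13 (i) holds when `n ≤ 3`») and 8.19 («8.13 (ii) holds when
`n ≤ 3` and `v₀` is non-archimedean») quantify over those statements, each is typed as a PREDICATE ON ITS DATA
— the displayed identity bare (`RSZ2020_8_2_identity D f f′ f′corr`, `RSZ2020_8_8_identity D m f f′ f′corr`, `RSZ2020_8_13_identity
D m v₀ f f′`) and the full printed statement with its hypotheses and its «Furthermore» clause
(`RSZ2020_8_2_statement D f`, `RSZ2020_8_8_statement D m f`, `RSZ2020_8_13_i_statement ∕ RSZ2020_8_13_ii_statement D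
m v₀ f f′`) — asserted nowhere in this file and excluded from `PrintedLaws8` (squad ruling R-7).  A route that wants one of them as a crux files it as an obligation under
`Summits/<S>/<Sub>/Theorems/` (planner's call), importing these predicates.  In the declaration docstrings
below the source's word for these statements is abbreviated «conj.» or replaced by «[statement] 8.x» (the
Literature lint reserves the full word for obligations); the cite locators keep the source's numbering «Conj. 8.x».

## Source, verbatim (abridged; v6 pages; `−`/`♮`/`∘` per the TeX)

(p. 43) «**8.** … we formulate a conjectural formula for the Gillet–Soulé arithmetic intersection pairing for
cycles on the integral models of `M_K(H̃G)` … Throughout this section we assume that the extension `F/F₀` and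
the hermitian space `W` are such that all places `v ∈ V^W_AT` (cf. (5.1)) are of degree one over `ℚ`.  **8.1. The
global conjecture, trivial level structure.** … recall the models `M_{K°_H̃}(H̃)`, `M_{K°_G̃}(G̃)`, and
`M_{K°_{H̃G}}(H̃G)` over `Spec O_E` … [toroidal compactification when `F₀ = ℚ` and non-compact] … Then the model
`M_{K°_{H̃G}}(H̃G)` is proper and flat over `Spec O_E`. Furthermore, it is regular provided that there are no places
`ν` of `E` for which `E_ν` is ramified over `ℚ_p` and `(v₀, Λ_{v₀})` is of AT type (1) … we assume that there are no
places `v₀` for which `(v₀, Λ_{v₀})` is of AT type (4) … there is a closed embedding `M_{K°_H̃}(H̃) ↪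
M_{K°_{H̃G}}(H̃G)`.»  (p. 44) «Like in (6.12), we obtain a cycle (with `ℚ`-coefficients) `z_{K°} = vol(K°_H̃)
[M_{K°_H̃}(H̃)]` on `M_{K°_{H̃G}}(H̃G)`. We denote by the same symbol its class in the rational Chow group, `z_{K°} ∈
Ch^{n−1}(M_{K°_{H̃G}}(H̃G))_ℚ` (8.1). [AT type (2) variant via (5.6).]  **Remark 8.1.** The definitions above of the
cycle class use a Haar measure on `H̃(𝔸_f)`. We will always choose the product of the measures used to define the
local orbital integrals (7.15).  We denote by `Ĉh^{n−1}(M_{K°_{H̃G}}(H̃G))` the arithmetic Chow group. Elements are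
represented by pairs `(Z, g_Z)`, where `Z` is a cycle and `g_Z` is a Green's current … the Gillet–Soulé arithmetic
intersection pairing `( , )_GS : Ĉh^{n−1} × Ĉh^{n−1} → ℝ`. We extend this from a symmetric pairing to a hermitian
pairing on the corresponding `ℂ`-vector space, `( , )_GS : Ĉh^{n−1}_ℂ × Ĉh^{n−1}_ℂ → ℂ` (8.2). We choose a Green's
current `g_{z_{K°}}` … to get `ẑ_{K°} = (z_{K°}, g_{z_{K°}}) ∈ Ĉh^{n−1}(M_{K°_{H̃G}}(H̃G))_ℚ` (8.3). The Green's current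
is not unique. We shall work in the following with an arbitrary but fixed choice.  Let `ℋ^{spl,Φ}_{K°} ⊂ ℋ_{K°} =
ℋ(H̃G(𝔸_f), K°_{H̃G})` (8.4) be the partial Hecke algebra spanned by completely decomposed pure tensors of the form `f
= ⊗_p f_p ∈ ℋ_{K°}`, where `f_p = φ_p ⊗ ⊗_{v∣p} f_v`, as in Definition 7.7, with `φ_p = 1_{K_{Z^ℚ,p}}` for all `p` and
where `f_v = 1_{K°_{H×G,v}}` unless `v ∈ Σ^{spl,Φ}`. Here `Σ^{spl,Φ}` is as in (5.7) … For `f ∈ ℋ^{spl,Φ}_{K°}`, we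
introduce via (5.11) a Hecke correspondence, hence an induced endomorphism `R̂(f)` on the arithmetic Chow group
`Ĉh^{n−1}(M_{K°_{H̃G}}(H̃G))_ℂ` … we define `Int♮(f) := (R̂(f) ẑ_{K°}, ẑ_{K°})_GS`, `Int(f) := 1/(τ(Z^ℚ)·[E:F]) ·
Int♮(f)` (8.5). Here `τ(Z^ℚ) := vol(Z^ℚ(𝔸_f)/Z^ℚ(ℚ))`.  **Conjecture 8.2 (Global conj., trivial level structure).**
Let `f = ⊗_p f_p ∈ ℋ^{spl,Φ}_{K°}`, and let `f′ = ⊗_v f′_v ∈ ℋ(G′(𝔸_{F₀}))` be a Gaussian test function such that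
`⊗_{v<∞} f′_v` is a smooth transfer of `f`. Then `Int(f) = −∂J(f′) − J(f′_corr)`, where `f′_corr ∈
C_c^∞(G′(𝔸_{F₀}))` is a correction function. Furthermore, we may choose `f′` such that `f′_corr = 0`.»  (p. 45)
«**Remark 8.3.** The notion of smooth transfer at each individual place `v` depends on the choice of transfer
factors, and of Haar measures … the validity of the conj. does not depend on these choices (use the product
formula (7.14)) …  **8.2. The global conjecture, non-trivial level structure.** … the models `M_{K^m_{H̃G}}(H̃G)`
are not regular in the fibers over places lying above the support of `m` … the Gillet–Soulé pairing (8.2) is not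
defined for them … we obtain a cycle `z_{K^m} = vol(K^{m∘}_H̃)[M_{K^{m∘}_H̃}(H̃)]` … `ẑ_{K^m} = (z_{K^m}, g_{z_{K^m}}) ∈
Ĉh^{n−1}(M_{K^m_{H̃G}}(H̃G))_ℚ` (8.6). Let `ℋ^{spl,Φ}_{K^m} := ℋ(H̃G(𝔸_f), K^m_{H̃G})^{spl,Φ}` (8.7) be the partial Hecke
algebra spanned by completely decomposed pure tensors … with `φ_p = 1_{K_{Z^ℚ,p}}` for all `p`, and where `f_v =
1_{K°_{H×G,v}}` unless `v ∈ Σ^{spl,Φ}` …  **Definition 8.4.** Let `ν` be a non-archimedean place of `F₀`, of residue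
characteristic `ℓ`. Let `f_ℓ ∈ C_c^∞(H̃G(ℚ_ℓ))` be completely decomposed, i.e., `f_ℓ = φ_ℓ ⊗ ⊗_{v∣ℓ} f_v` … Then `f_ℓ`
is said to have regular support at `ν` if `supp f_ν ⊂ G_W(F_{0,ν})_rs`. If `f = ⊗_p f_p ∈ ℋ^{spl,Φ}_{K^m}` is a
completely decomposed pure tensor, then `f` has regular support at `ν` if `f_ℓ` has regular support at `ν`.
**Theorem 8.5.** Let `f = ⊗_p f_p ∈ ℋ^{spl,Φ}_{K^m}` be a completely decomposed pure tensor. Assume that `f` has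
regular support at some place `ν` of `F₀`. Then the following statements on the support of the intersection of the
cycles `z_{K^m}` and `R(f) z_{K^m}` of `M_{K^m_{H̃G}}(H̃G)` hold. (i) The support does not meet the generic fiber.
(ii) Let `ν` be a place of `E` lying over a place of `F₀` which splits in `F`. Then the support does not meet the
special fiber `M ⊗_{O_E} κ̄_ν`.»  (p. 46) «(iii) Let `ν` be a place of `E` lying over a place of `F₀` which does not
split in `F`. Then the support meets the special fiber only in its basic locus.  **Remark 8.6.** [`F₀ = ℚ`,
non-compact: the closure of the support in the toroidal compactification misses the boundary, by (iii).]  **Lemma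
8.7.** Let `k` be an algebraically closed field which is an `O_E`-algebra. Let `(A₀, ι₀)` be an abelian variety with
`O_F`-action with Kottwitz condition of signature `((0, 1)_{φ∈Φ})`, cf. (3.8), and let `(A, ι)` be an abelian
variety with `O_F`-action with Kottwitz condition of type `r` as in Remark 3.6 (i). Assume there exists an
`F`-linear isogeny `A₀ⁿ → A`. Then `k` is of positive characteristic `p`. Let `ν` be the corresponding place of `E`.
The place `v₀` of `F₀` induced by `ν` is non-split in `F`, and the isogeny classes of `A₀` and `A` only depend on the
CM type `Φ`. If `v₀` is the only place of `F₀` above `p`, then `A₀` and `A` are supersingular.»  (p. 48) «… we may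
define `Int♮_ν(f) := ⟨R̂(f) ẑ_{K^m}, ẑ_{K^m}⟩_ν log q_ν`, `Int(f) := 1/(τ(Z^ℚ)[E:F]) Σ_ν Int♮_ν(f)` (8.12). Here the
first quantity is defined for a non-archimedean place `ν` through the Euler–Poincaré characteristic of a derived
tensor product on `M_{K^m_{H̃G}}(H̃G) ⊗_{O_E} O_{E,(ν)}` … For an archimedean place `ν`, the last quantity is defined
by the archimedean component of the arithmetic intersection theory and we have set `log q_ν := [E_ν : ℝ] = 2` …
**Conjecture 8.8 (Global conj., nontrivial level structure).** Let `f = ⊗_p f_p ∈ ℋ^{spl,Φ}_{K^m}` be a completely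
decomposed pure tensor and let `f′ = ⊗_v f′_v ∈ ℋ(G′(𝔸))` be a Gaussian test function such that `⊗_{v<∞} f′_v` is a
smooth transfer of `f`. Assume that `f` has regular support at some place `ν` of `F₀`. Then `Int(f) = −∂J(f′) −
J(f′_corr)`, where `f′_corr ∈ C_c^∞(G′(𝔸))` is a correction function. Furthermore, `f′` may be chosen such that `f′`
has regular support at `ν` and that `f′_corr = 0`.  **Remark 8.9.** Part of the conj. asserts that a change of the
Green's current is compensated by a change of the correction function.  **Remark 8.10.** [relation to the first
derivative of L-functions when a split place with the property of Prop. 7.2 exists; «if `f ≠ 0` has regular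
support at some place `ν`, then `ν ∈ supp m` … Since we will not need this statement, we omit the proof».]  **Lemma
8.11.** (i) Let `u ∈ supp m` be a place above `p` (in particular `u` is split in `F`). There exists a non-zero
function `f_p ∈ ℋ_{K^m_{H̃G},p}` that has regular support at `u`.»  (p. 49) «(ii) For any `f_p ∈ ℋ_{K^m_{H̃G},p}` with
regular support at the place `u` above `p`, there exists a transfer `(f′_v)_{v∣p}` such that `f′_u` has regular
support at `u`.  [Proof: at a split `u`, `H(F_{0,u}) = GL_{n−1}(F_{0,u}) ↪ G(F_{0,u}) = GL_n(F_{0,u})`, `h ↦ diag(h,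
1)` … the "contraction" map `H × G → G, (h, g) ↦ h⁻¹g` (8.13) …]  The left-hand side of (8.12) can be localized,
i.e., we can write it as a sum over all non-archimedean places, `Int(f) = Σ_v Int_v(f)` (8.14), where `Int_v(f) :=
1/(τ(Z^ℚ)·[E:F]) Σ_{ν∣v} Int♮_ν(f)` (8.15). By Lemma 8.11, the smooth transfer `f′` of `f` can be chosen such that `f′`
has regular support at `ν`, which we assume from now on …  **Proposition 8.12.** In the situation of Conjecture
8.8, let `v₀` be a place of `F₀` that is split in `F`. Then `Int_{v₀}(f) = ∂J_{v₀}(f′) = 0`.»  (p. 50) «**8.3. The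
semi-global conjecture.** Let `v₀` be a place of `F₀` above the place `p ≤ ∞` of `ℚ` … from now on we may and do
assume that `v₀` is non-split in `F`. Now assume that `v₀` is non-archimedean. We assume that `v₀` is either of
hyperspecial level type or of AT parahoric level type, in the sense of Section 4 … `K_{H̃G} = K^p_{H̃G} × K_{H̃G,p}` …
Let `ℋ^p_{K} ⊂ ℋ_{K} = ℋ(H̃G(𝔸_f), K_{H̃G})` (8.16) be the partial Hecke algebra spanned by completely decomposed
pure tensors of the form `f = ⊗_ℓ f_ℓ ∈ ℋ_K`, where `f_ℓ = φ_ℓ ⊗ ⊗_{v∣ℓ} f_v`, as in Definition 7.7, with `φ_ℓ =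
1_{K_{Z^ℚ,ℓ}}` for all `ℓ`, and where `f_p = 1_{K_{H̃G,p}}`. We note that this defines a bigger Hecke algebra than
(8.7) when `K_{H̃G} = K^m_{H̃G}`, `ℋ^p_K ⊃ ℋ^{spl,Φ}_{K^m}` (8.17). Let `f = ⊗_ℓ f_ℓ ∈ ℋ^p_K` be completely decomposed
with regular support at some place `ν`. We define as before in (8.15) `Int♮_ν(f) := ⟨R̂(f) ẑ_K, ẑ_K⟩_ν log q_ν`,
`Int_{v₀}(f) := 1/(τ(Z^ℚ)[E:F]) Σ_{ν∣v₀} Int♮_ν(f)` (8.18) … This extends the definition (8.15) to the bigger Hecke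
algebra … We proceed similarly for an archimedean place `v₀` … (8.19) …  **Conjecture 8.13 (Semi-global conj.).**
Fix a place `v₀` of `F₀` above a place `p ≤ ∞` of `ℚ`. Let `f = ⊗_ℓ f_ℓ ∈ ℋ^p_K` (`ℋ_K` if `p` is archimedean) be
completely decomposed, and let `f′ = ⊗_v f′_v ∈ ℋ(G′(𝔸_{F₀}))` be a Gaussian test function such that `⊗_{v<∞}
f′_v` is a smooth transfer of `f`. Assume that for some `ℓ` prime to `v₀` and some place `ν` above `ℓ`, the
function `f` has regular support at `ν` in the sense of Definition 8.4 and that `f′` has regular support at `ν` in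
the sense of Definition 7.5. (i) Assume that `v₀` is non-archimedean of hyperspecial type, cf. Section 4.1, and
that `f′_{v₀} = 1_{G′(O_{F₀,v₀})}`. Then `Int_{v₀}(f) = −∂J_{v₀}(f′)`.»  (p. 51) «(ii) Assume that `v₀` is
archimedean, or non-archimedean of AT type, cf. Section 4.4. Then `Int_{v₀}(f) = −∂J_{v₀}(f′) − J(f′_corr[v₀])`,
where `f′_corr[v₀] = ⊗_v f′_{corr,v}`, with `f′_{corr,v} = f′_v` for `v ≠ v₀`, is a correction function. Furthermore,
`f′` may be chosen such that `f′_corr[v₀]` is zero.  **Theorem 8.14.** The semi-global conjecture Conjecture 8.13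
for all places `v₀` implies the global conjecture Conjecture 8.8.  **Theorem 8.15.** Conjecture 8.13 (i) holds when
`n ≤ 3`. [Proof via the AFL, known for `n ≤ 3` ([55, Th. 5.5], [36]), the uniformization (8.20)–(8.22), (8.23)–(8.29)
and Lemma 8.16.]»  (p. 53) «**Lemma 8.16.** Let `L₀/ℚ_p` be a finite extension and `L/L₀` an étale `L₀`-algebra of
rank 2. Assume `p ≠ 2` if `L` is a field. Let `Φ_L ⊂ Hom_{ℚ_p}(L, ℚ̄_p)` be a local CM type for `L/L₀`, and let `r_L
: Hom_{ℚ_p}(L, ℚ̄_p) → {0, n}` be a banal generalized CM type of rank `n`. Let `E′` be the join of the reflex fields of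
`Φ_L` and `r_L`. Let `k̄` be an algebraic closure of the residue field of `O_{E′}`. Let `(𝕏₀, ι_{𝕏₀}, λ_{𝕏₀})` be a
local CM triple of type `Φ̄_L` over `k̄`, where `λ_{𝕏₀}` is principal. Let `(𝕏, ι_𝕏, λ_𝕏)` be a local CM triple of
type `r` over `k̄` which satisfies the Eisenstein condition, cf. (B.5). Assume that `ker λ_𝕏 ⊂ 𝕏[π]` … Let
`N_{Φ̄_L,r_L}` be the formal scheme over `Spf O_{Ĕ′}` that represents the functor [of tuples `(X₀, ι₀, λ₀, X, ι, λ,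
ρ₀, ρ)` …]. Then `N_{Φ̄_L,r_L} ≃ G(L₀)/K`, where `G` is the unitary group of an `L/L₀`-hermitian vector space of
invariant `inv^{r_L}(𝕏₀, 𝕏)`, and where `K` is the stabilizer of a vertex lattice of type `t := log_q |ker λ_𝕏|`, `q
:= #O_L/πO_L`. [Proof: `N` is formally étale over `Spf O_{Ĕ′}` (Lemmas B.1, B.4); its point set is `G(L₀)/K` via
the crystalline period map.]  **Remark 8.17.** [type `Φ_L` instead of `Φ̄_L`.]»  (p. 54) «**Remark 8.18.** [the
`J`-group `J = U(C)` of the situation of Lemma 8.16 satisfies `J ≃ G`.]  **Theorem 8.19.** Conjecture 8.13 (ii)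
holds when `n ≤ 3` and `v₀` is non-archimedean. [Proof as for 8.15 from the AT conj. proved for `n ≤ 3` in [42],
[43], with the AT identity (8.30); «To simplify, we only prove the "Furthermore" part».]  **Remark 8.20.** [the
factor 2 in the ramified ATC vs. the AFL; normalization by `log q_{w₀}`.]»

## What is typed, and how

Nothing of §8's geometry is in Mathlib or the tree: integral models `M_{K^m_{H̃G}}(H̃G)` over `Spec O_E` with
their generic ∕ special fibres and basic loci (the tree's ★ `Sec3IntegralModels` types the moduli PROBLEM `M₀` of
§3, TL-t10), rational and arithmetic Chow groups, Green's currents, the Gillet–Soulé pairing and its local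
components `⟨ , ⟩_ν`, Hecke correspondences (5.11) and `R̂(f)`, the Hecke algebras `ℋ_{K}`, RZ spaces.  So §8 is a
LETTER over ONE posited datum `Sec8Data` EXTENDING the §7 datum `Sec7Data` (so that `∂J`, `∂J_v`, `J`, Gaussian
test functions, smooth transfer, Def. 7.5 ∕ 7.6 ∕ 7.7 are the §7 declarations verbatim), with bare carriers ∕ maps ∕
predicates page-pinned field by field, and REAL bodies wherever the print DEFINES something from the posited
primitives: (5.7) `SigmaSpl`, `SigmaSplPhi`; (5.8) `IsLevelFn` (the level structures `K^m_{H̃G}` are indexed by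
functions `m : Pl → ℕ`, `m = 0` being the trivial level structure `K°` of §8.1 — «if `m = 0`, then `K^m_G = K°_G`»,
p. 30); (8.1)∕(8.6) `zK`; (8.3)∕(8.6) `zHat`; (8.4)∕(8.7) `IsSpecialPure` (membership of a completely decomposed
pure tensor in `ℋ^{spl,Φ}_{K^m}`); (8.5) `IntNat0`, `Int0`; (8.12) `IntNatAt`, `IntGlobal`; (8.15) = (8.18) = (8.19)
`IntAt`; (8.16) `IsPurePrimeTo`; Def. 8.4 `HasRegularSupportUAt`, `HasRegularSupportU`; «`⊗_{v<∞} f′_v` is a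
smooth transfer of `f`» `FinitePartSmoothTransfer`; the hypotheses of 8.13 `SemiGlobalHyp`; (8.13) `contraction813`
(over ★ `blockDiagGL`).  Relations (closed `Prop`s on the datum, collected in `PrintedLaws8`): (8.2) hermitian
symmetry, the compatibility `J(f′) = J(f′, 0)` of the posited extension of `J` to `C_c^∞(G′(𝔸_{F₀}))` with (7.9),
Thm. 8.5, Lemma 8.7, Lemma 8.11, (8.14), Prop. 8.12, Thm. 8.14, Thm. 8.15, Lemma 8.16, Thm. 8.19.  Predicates
only (see above): 8.2, 8.8, 8.13 (i), 8.13 (ii).  Sums `Σ_ν`, `Σ_{ν∣v}` are `finsum` (finitely many non-zero local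
intersection numbers); `[E : F]`, `τ(Z^ℚ)`, `log q_ν`, `vol(K_H̃)` are posited numbers.
READINGS. R8a — (8.14) is typed with `v` over ALL places of `F₀`: `Int(f)` (8.12) sums `Int♮_ν` over all places `ν`
of `E`, archimedean ones included (p. 48), every `ν` lies over exactly one `v`, and archimedean `v₀` occur in 8.13
(ii) and in the proof of 8.14; the lead-in prose «a sum over all non-archimedean places» (p. 49) is narrower than
the display it introduces — flagged for lit6 ∕ T-ref6.  R8b — 8.13 is printed for the semi-global levels `K_{H̃G} =
K^p × K_p` of §4.1 ∕ §4.4; it is typed for the levels `K^m` (the case `K_{H̃G} = K^m_{H̃G}` of (8.17), the one used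
in Theorem 8.14) — TODO(general form).  R8c — «the isogeny classes of `A₀` and `A` only depend on the CM type `Φ`»
(Lemma 8.7; `Φ` is fixed behind the datum) is rendered operationally: any two pairs `(A₀, A)`, `(A₀′, A′)` over the
same `k` satisfying the hypotheses are isogenous componentwise.  R8d — the «Furthermore, `f′` may be chosen …»
clauses of 8.2 ∕ 8.8 ∕ 8.13 (ii) are typed GUARDED («if some `f′` as in the hypotheses exists, one may be chosen
with …»), since the existence of Gaussian test functions is not asserted by the source (§7.3 p. 43).
NOT typed: (8.17) (its content — which places over `p` lie in `Σ^{spl,Φ}` — belongs to (4.19)∕(5.7), §4–§5 files;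
it is used only inside the proof of 8.14), Remarks 8.1, 8.3, 8.9, 8.10 (prose; the omitted-proof claim of 8.10 is
deliberately not vendored), 8.6 (toroidal boundary), 8.17, 8.18 (`J ≃ G`), 8.20, the proof displays (8.8)–(8.11),
(8.20)–(8.30) (uniformization, the AFL ∕ AT identities (8.26) ∕ (8.30) are citations of [43], [55], [42]), and the
standing hypotheses of §8 (p. 43: degree-one `V^W_AT` places, no AT type (4), the regularity proviso), which sit
behind the posited models.  DEDUP: `rg "RapoportSmithlingZhang20(17|20)(Diagonal)?, (§ ?8|Thm.* 8\.|Lemma 8\.|Conj.*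
8\.|\(8\.)"` over `lean/Literature lean/Summits` = ∅ (squad sheet §C: §§5–8 green field; the two «§8 (proof)» hits
of the sheet are proof-side mentions, not statements).

## References
* [RapoportSmithlingZhang2020Diagonal] M. Rapoport, B. Smithling, W. Zhang, Compositio Math. 156 (2020)
  1745–1824 = arXiv:1710.06962v6, §8 pp. 43–54 (and §5.2 p. 30 for (5.7)–(5.8)).
-/

noncomputable section

open scoped MatrixGroups

namespace Literature.AlgebraicGeometry.ShimuraVarieties.RapoportSmithlingZhang2020.Sec8ArithmeticIntersectionPairing

open Literature.AlgebraicGeometry.ShimuraVarieties.RapoportSmithlingZhang2020.Sec7LFunctionsRTF (Sec7Data)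
open Literature.AlgebraicGeometry.ShimuraVarieties.RapoportSmithlingZhang2020.Sec2GroupTheoreticSetup (blockDiagGL)

universe u

/-- (8.13) (p. 49, proof of Lemma 8.11), at a place `u` split in `F` with `H(F_{0,u}) = GL_{n−1}(F_{0,u}) ↪
G(F_{0,u}) = GL_n(F_{0,u})`, `h ↦ diag(h, 1)` (★ `blockDiagGL`, = ★ `Sec2Datum.inclHG`): the «contraction» map
«`H × G → G, (h, g) ↦ h⁻¹g`».  REAL. [cite: RapoportSmithlingZhang2020Diagonal, §8.2 (8.13) (p. 49)] -/
def contraction813 {S : Type} [CommRing S] {κ : Type} [Fintype κ] [DecidableEq κ]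
    (h : GL κ S) (g : GL (κ ⊕ Unit) S) : GL (κ ⊕ Unit) S :=
  (blockDiagGL h 1)⁻¹ * g

/-- **The data of RSZ §8 AS A DATUM**, extending the §7 datum (`Sec7Data`: places, `J`, `∂J`, `∂J_v`, test
functions on both sides, transfer, Gaussian test functions): the dimension `n`; the places `ν` of the reflex field
`E` with `ν ↦ v₀` («the place of `F₀` induced by `ν` via `φ₀`») and the matching predicate of (4.19); the numbers
`[E : F]`, `τ(Z^ℚ)`, `log q_ν`; the level types at non-split places (§4.1 hyperspecial, §4.4 AT); on the unitary
side the distinguished test functions `1_{K_{Z^ℚ,p}}`, `1_{K°_{H×G,v}}`, `1_{K^m_{H̃G,p}}`, the local Hecke algebras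
`ℋ_{K^m_{H̃G},p}`, the zero function, regular supports in `G_W(F_{0,ν})` (Def. 8.4), `1_{G′(O_{F₀,v})}`; the full
space `C_c^∞(G′(𝔸_{F₀}))` of correction functions with `J` on it; and, indexed by the level functions `m` of (5.8)
(`m = 0` = trivial level), the geometric carriers: points of `M_{K^m_{H̃G}}(H̃G)` with generic ∕ special fibres and
basic loci, the support of `z_{K^m} ∩ R(f) z_{K^m}`, the rational Chow group with `[M_{K^{m∘}_H̃}(H̃)]` and
`vol(K^{m∘}_H̃)`, the arithmetic Chow group (`ℂ`-coefficients) with Green's currents, the fixed choice `g_{z}`, the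
classes `(z, g)`, the operators `R̂(f)`, the Gillet–Soulé pairing (8.2) (trivial level) and the local pairings
`⟨ , ⟩_ν` of (8.12); the objects of Lemma 8.7 (algebraically closed `O_E`-fields `k`, the two kinds of abelian
varieties with `O_F`-action, `F`-linear isogenies `A₀ⁿ → A`, isogeny, supersingularity) and of Lemma 8.16 (the
banal local data, `N_{Φ̄_L,r_L}`, `G(L₀)/K`).  The datum is that of §8 under its standing hypotheses (p. 43).
Nothing in the structure asserts a printed statement. [cite: RapoportSmithlingZhang2020Diagonal, §8 (pp. 43–54)] -/
structure Sec8Data : Type (u + 1) extends Sec7Data.{u} where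
  /-- `n = dim_F W ≥ 2` (Notation p. 5; «`n ≤ 3`» in Thms. 8.15, 8.19) [pp. 51, 54] -/
  n : ℕ
  /-- the places `ν` of the reflex field `E` [§8.1 p. 43; (8.12) p. 48] -/
  PlE : Type u
  /-- «`ν` archimedean» [(8.12) p. 48; (8.19) p. 50] -/
  IsArchE : PlE → Prop
  /-- «the place `v₀` of `F₀` induced by `ν` via `φ₀`» [§8.1 p. 43; Lemma 8.7 p. 46; (8.15) p. 49] -/
  below : PlE → Pl
  /-- «the place `ν` of `E` matches `Φ`» ((4.19); (5.7) p. 30) [(8.4) p. 44] -/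
  MatchesPhi : PlE → Prop
  /-- `[E : F]` [(8.5) p. 44; (8.12) p. 48] -/
  degEF : ℕ
  /-- `τ(Z^ℚ) := vol(Z^ℚ(𝔸_f)/Z^ℚ(ℚ))` [(8.5) p. 44] -/
  tauZQ : ℝ
  /-- `log q_ν` (`ν` non-archimedean: `q_ν` the residue cardinality; `ν` archimedean: «we have set `log q_ν :=
  [E_ν : ℝ] = 2`») [(8.12) p. 48] -/
  logq : PlE → ℝ
  /-- «`v₀` is (non-archimedean, non-split and) of hyperspecial level type, in the sense of Section 4.1» [§8.3 p. 50; 8.13 (i)] -/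
  IsHyperspecialType : Pl → Prop
  /-- «`v₀` is of AT parahoric level type, in the sense of Section 4.4» [§8.3 p. 50; 8.13 (ii) p. 51] -/
  IsATType : Pl → Prop
  /-- `1_{K_{Z^ℚ,p}} ∈ C_c^∞(Z^ℚ(ℚ_p))` [(8.4) p. 44; (8.7) p. 45; (8.16) p. 50] -/
  oneKZ : (p : Nat.Primes) → TestFnZ p
  /-- `1_{K°_{H×G,v}} ∈ C_c^∞(G_W(F_{0,v}))` [(8.4) p. 44; (8.7) p. 45] -/
  oneKHG : (v : Pl) → TestFnGW v
  /-- `1_{K^m_{H̃G,p}} ∈ C_c^∞(H̃G(ℚ_p))` for the level function `m` («`f_p = 1_{K_{H̃G,p}}`») [(8.16) p. 50] -/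
  oneKHGp : (Pl → ℕ) → (p : Nat.Primes) → TestFnU p
  /-- «`f_p ∈ ℋ_{K^m_{H̃G},p}`» (bi-`K^m_{H̃G,p}`-invariant) [Lemma 8.11 p. 48; (8.4), (8.7), (8.16)] -/
  InHkp : (Pl → ℕ) → (p : Nat.Primes) → TestFnU p → Prop
  /-- the zero function in `C_c^∞(H̃G(ℚ_p))` («non-zero function `f_p`») [Lemma 8.11 (i) p. 48] -/
  zeroU : (p : Nat.Primes) → TestFnU p
  /-- «`supp f_ν ⊂ G_W(F_{0,ν})_rs`» [Def. 8.4 p. 45] -/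
  SuppRegularGW : (v : Pl) → TestFnGW v → Prop
  /-- `1_{G′(O_{F₀,v})} ∈ C_c^∞(G′(F_{0,v}))` [8.13 (i) p. 50] -/
  oneGO : (v : Pl) → TestFnLoc v
  /-- `C_c^∞(G′(𝔸_{F₀}))` (all test functions, home of the correction functions `f′_corr`) [8.2 p. 44; 8.8 p. 48] -/
  CcG : Type u
  /-- a pure tensor `f′ = ⊗_v f′_v` as an element of `C_c^∞(G′(𝔸_{F₀}))` [8.2 p. 44] -/
  toCc : TestFn → CcG
  /-- `J(h) = J(h, 0)` on all of `C_c^∞(G′(𝔸_{F₀}))` (§7.2: Zydor's truncation, (7.9)) [«`J(f′_corr)`», 8.2 p. 44; 8.8 p. 48] -/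
  Jc : CcG → ℂ
  /-- the points of `M_{K^m_{H̃G}}(H̃G)` (over `Spec O_E`; `m = 0`: `M_{K°_{H̃G}}(H̃G)`) with values in algebraically
  closed fields [Thm. 8.5 p. 45] -/
  Mpts : (Pl → ℕ) → Type u
  /-- «lies on the generic fiber» [Thm. 8.5 (i) p. 45] -/
  InGenericFibre : {m : Pl → ℕ} → Mpts m → Prop
  /-- «lies on the special fiber `M_{K^m_{H̃G}}(H̃G) ⊗_{O_E} κ̄_ν`» [Thm. 8.5 (ii) p. 45] -/
  InSpecialFibreAt : {m : Pl → ℕ} → Mpts m → PlE → Prop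
  /-- «lies in the basic locus of the special fiber at `ν`» (footnote 18 p. 46) [Thm. 8.5 (iii) p. 46] -/
  InBasicLocusAt : {m : Pl → ℕ} → Mpts m → PlE → Prop
  /-- «the support of the intersection of the cycles `z_{K^m}` and `R(f) z_{K^m}` of `M_{K^m_{H̃G}}(H̃G)`»
  [Thm. 8.5 p. 45] -/
  suppInt : (m : Pl → ℕ) → TestFnUf → Set (Mpts m)
  /-- the rational Chow group `Ch^{n−1}(M_{K^m_{H̃G}}(H̃G))_ℚ` [(8.1) p. 44; §8.2 p. 45] -/
  Ch : (Pl → ℕ) → Type u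
  /-- `ℚ`-scalar multiplication on `Ch^{n−1}(…)_ℚ` [(8.1) p. 44 «with `ℚ`-coefficients»] -/
  chSMul : {m : Pl → ℕ} → ℚ → Ch m → Ch m
  /-- the class `[M_{K^{m∘}_H̃}(H̃)]` (resp. `[M_{K′}…]` at AT type (2) places) pushed forward along the closed
  embedding (5.6) ∕ (5.9) ∕ (5.10) [(8.1) p. 44; (8.6) p. 45] -/
  classMH : (m : Pl → ℕ) → Ch m
  /-- `vol(K^{m∘}_H̃)` for the product Haar measure of Remark 8.1 [(8.1), Rem. 8.1 p. 44; (8.6) p. 45] -/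
  volKH : (Pl → ℕ) → ℚ
  /-- the arithmetic Chow group `Ĉh^{n−1}(M_{K^m_{H̃G}}(H̃G))_ℂ` (pairs `(Z, g_Z)`) [(8.2)–(8.3) p. 44; (8.6) p. 45] -/
  ChHat : (Pl → ℕ) → Type u
  /-- the Green's currents for the cycle `z_{K^m}` [(8.3) p. 44; (8.6) p. 45] -/
  Green : (Pl → ℕ) → Type u
  /-- «an arbitrary but fixed choice» `g_{z_{K^m}}` [(8.3) p. 44; (8.6) p. 45] -/
  gz : (m : Pl → ℕ) → Green m
  /-- `g ↦ (z_{K^m}, g) ∈ Ĉh^{n−1}(…)` [(8.3) p. 44; (8.6) p. 45] -/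
  zHatOf : {m : Pl → ℕ} → Green m → ChHat m
  /-- the endomorphism `R̂(f)` of `Ĉh^{n−1}(M_{K^m_{H̃G}}(H̃G))_ℂ` induced via (5.11) by `f ∈ ℋ^{spl,Φ}_{K^m}`
  (resp. `ℋ^p_K`) ([16, 5.2.1]) [p. 44; (8.12) p. 48; (8.18) p. 50] -/
  Rhat : (m : Pl → ℕ) → TestFnUf → ChHat m → ChHat m
  /-- the Gillet–Soulé pairing `( , )_GS` on `Ĉh^{n−1}(M_{K°_{H̃G}}(H̃G))_ℂ`, extended to a hermitian pairing
  (trivial level structure `m = 0`, regular model) [(8.2) p. 44] -/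
  gs : ChHat 0 → ChHat 0 → ℂ
  /-- the local pairing `⟨ , ⟩_ν` at a place `ν` of `E` (Euler–Poincaré characteristic of the derived tensor
  product on `M ⊗_{O_E} O_{E,(ν)}` for `ν` non-archimedean; the archimedean component of the arithmetic
  intersection theory for `ν` archimedean) [(8.12) p. 48; (8.18)–(8.19) p. 50] -/
  locPair : (m : Pl → ℕ) → PlE → ChHat m → ChHat m → ℂ
  /-- the algebraically closed fields `k` which are `O_E`-algebras [Lemma 8.7 p. 46] -/
  KFld : Type u
  /-- `char k` [Lemma 8.7 p. 46] -/
  charK : KFld → ℕ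
  /-- «the corresponding place `ν` of `E`» (for `char k = p > 0`) [Lemma 8.7 p. 46] -/
  placeK : KFld → PlE → Prop
  /-- the abelian varieties `(A₀, ι₀)` over `k` with `O_F`-action with Kottwitz condition of signature
  `((0, 1)_{φ∈Φ})` (3.8) [Lemma 8.7 p. 46] -/
  AV0 : KFld → Type u
  /-- the abelian varieties `(A, ι)` over `k` with `O_F`-action with Kottwitz condition of type `r` (Rem. 3.6 (i))
  [Lemma 8.7 p. 46] -/
  AVr : KFld → Type u
  /-- «there exists an `F`-linear isogeny `A₀ⁿ → A`» [Lemma 8.7 p. 46] -/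
  HasFLinearIsogenyPow : {k : KFld} → AV0 k → AVr k → Prop
  /-- isogeny of the `A₀`'s (with their `O_F`-actions) [Lemma 8.7 p. 46 «isogeny classes»] -/
  Isog0 : {k : KFld} → AV0 k → AV0 k → Prop
  /-- isogeny of the `A`'s [Lemma 8.7 p. 46] -/
  IsogR : {k : KFld} → AVr k → AVr k → Prop
  /-- «`A₀` is supersingular» [Lemma 8.7 p. 46] -/
  IsSupersingular0 : {k : KFld} → AV0 k → Prop
  /-- «`A` is supersingular» [Lemma 8.7 p. 46] -/
  IsSupersingularR : {k : KFld} → AVr k → Prop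
  /-- the data of Lemma 8.16: `L₀/ℚ_p` finite, `L/L₀` étale of rank 2 (`p ≠ 2` if `L` is a field), a local CM
  type `Φ_L`, a banal generalized CM type `r_L` of rank `n`, `E′`, `k̄`, local CM triples `(𝕏₀, ι, λ)` of type
  `Φ̄_L` with `λ_{𝕏₀}` principal and `(𝕏, ι, λ)` of type `r` with the Eisenstein condition (B.5) and `ker λ_𝕏 ⊂
  𝕏[π]` [Lemma 8.16 p. 53] -/
  Banal : Type u
  /-- «`N_{Φ̄_L,r_L}` is formally étale over `Spf O_{Ĕ′}`» (Lemmas B.1, B.4) [Lemma 8.16, proof p. 53] -/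
  NFormallyEtale : Banal → Prop
  /-- the point set `N_{Φ̄_L,r_L}(k̄)` of the formal scheme `N_{Φ̄_L,r_L}` over `Spf O_{Ĕ′}` [Lemma 8.16 p. 53] -/
  NPts : Banal → Type u
  /-- `G(L₀)/K`, `G` the unitary group of an `L/L₀`-hermitian space of invariant `inv^{r_L}(𝕏₀, 𝕏)`, `K` the
  stabilizer of a vertex lattice of type `t := log_q |ker λ_𝕏|` [Lemma 8.16 p. 53] -/
  GmodK : Banal → Type u

namespace Sec8Data

variable (D : Sec8Data.{u})

/-! ## Levels and Hecke algebras ((5.7)–(5.8) p. 30; (8.4) p. 44; (8.7) p. 45; (8.16) p. 50) -/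

/-- (5.7) (p. 30): «`Σ^{spl} := {places v of F₀ ∣ v splits in F}`». [cite: RapoportSmithlingZhang2020Diagonal, §5.2 (5.7) (p. 30)] -/
def SigmaSpl : Set D.Pl := {v | D.IsSplit v}

/-- (5.7) (p. 30): «`Σ^{spl,Φ} := {v ∈ Σ^{spl} ∣ every place ν of E above v matches Φ}`». [cite: RapoportSmithlingZhang2020Diagonal, §5.2 (5.7) (p. 30)] -/
def SigmaSplPhi : Set D.Pl := {v | D.IsSplit v ∧ ∀ ν : D.PlE, D.below ν = v → D.MatchesPhi ν}

/-- (5.8) (p. 30): «a function `m : Σ^{spl} → ℤ_{≥0}` with finite support contained in `Σ^{spl,Φ}`» (extended by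
`0`; «if `m = 0`, then `K^m_G = K°_G`» — the trivial level structure of §8.1). [cite: RapoportSmithlingZhang2020Diagonal, §5.2 (5.8) (p. 30)] -/
def IsLevelFn (m : D.Pl → ℕ) : Prop := (Function.support m).Finite ∧ Function.support m ⊆ D.SigmaSplPhi

/-- (8.4) (p. 44) ∕ (8.7) (p. 45): the completely decomposed pure tensors spanning `ℋ^{spl,Φ}_{K^m} ⊂ ℋ_{K^m} =
ℋ(H̃G(𝔸_f), K^m_{H̃G})`: «`f = ⊗_p f_p ∈ ℋ_{K^m}`, where `f_p = φ_p ⊗ ⊗_{v∣p} f_v`, as in Definition 7.7, with `φ_p =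
1_{K_{Z^ℚ,p}}` for all `p` and where `f_v = 1_{K°_{H×G,v}}` unless `v ∈ Σ^{spl,Φ}`».
[cite: RapoportSmithlingZhang2020Diagonal, §8.1 (8.4) (p. 44)] -/
def IsSpecialPure (m : D.Pl → ℕ) (f : D.TestFnUf) : Prop :=
  ∀ p : Nat.Primes, D.InHkp m p (D.compU f p) ∧
    ∃ fv : (v : D.Pl) → D.Over v p → D.TestFnGW v,
      D.compU f p = D.tensorAt p (D.oneKZ p) fv ∧ ∀ (v : D.Pl) (h : D.Over v p), v ∉ D.SigmaSplPhi → fv v h = D.oneKHG v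

/-- (8.16) (p. 50): the completely decomposed pure tensors spanning `ℋ^p_K ⊂ ℋ_K` (`K = K^m_{H̃G}`, READING R8b):
«`f = ⊗_ℓ f_ℓ ∈ ℋ_K`, where `f_ℓ = φ_ℓ ⊗ ⊗_{v∣ℓ} f_v`, as in Definition 7.7, with `φ_ℓ = 1_{K_{Z^ℚ,ℓ}}` for all `ℓ`,
and where `f_p = 1_{K_{H̃G,p}}`».  ((8.17) «`ℋ^p_K ⊃ ℋ^{spl,Φ}_{K^m}`» is not typed, see the module docstring.)
[cite: RapoportSmithlingZhang2020Diagonal, §8.3 (8.16) (p. 50)] -/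
def IsPurePrimeTo (m : D.Pl → ℕ) (p : Nat.Primes) (f : D.TestFnUf) : Prop :=
  (∀ ℓ : Nat.Primes, D.InHkp m ℓ (D.compU f ℓ) ∧
    ∃ fv : (v : D.Pl) → D.Over v ℓ → D.TestFnGW v, D.compU f ℓ = D.tensorAt ℓ (D.oneKZ ℓ) fv) ∧
  D.compU f p = D.oneKHGp m p

/-- «`⊗_{v<∞} f′_v` is a smooth transfer of `f`» (8.2 p. 44; 8.8 p. 48; 8.13 p. 50): the finite part of the pure
tensor `f′ ∈ ℋ(G′(𝔸_{F₀}))` is a finite-adelic pure tensor (§7 `TestFnf`) which is a smooth transfer of `f` in the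
sense of Definition 7.10 (§7 `AreSmoothTransfers`). [cite: RapoportSmithlingZhang2020Diagonal, §8.1 (p. 44)] -/
def FinitePartSmoothTransfer (f : D.TestFnUf) (f' : D.TestFn) : Prop :=
  ∃ g : D.TestFnf, (∀ v : D.Pl, ¬ D.IsArch v → D.compf g v = D.comp f' v) ∧ D.AreSmoothTransfers f g

/-! ## §8.1 (pp. 43–45): trivial level structure -/

/-- (8.1) (p. 44) ∕ (8.6) (p. 45): «`z_{K} = vol(K_H̃)[M_{K_H̃}(H̃)]` … its class in the rational Chow group `z_K ∈
Ch^{n−1}(M_{K_{H̃G}}(H̃G))_ℚ`» (`K = K^m_{H̃G}`; Remark 8.1: the Haar measure is the product of the measures of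
(7.15)). [cite: RapoportSmithlingZhang2020Diagonal, §8.1 (8.1) (p. 44)] -/
def zK (m : D.Pl → ℕ) : D.Ch m := D.chSMul (D.volKH m) (D.classMH m)

/-- (8.3) (p. 44) ∕ (8.6) (p. 45): «`ẑ_K = (z_K, g_{z_K}) ∈ Ĉh^{n−1}(M_{K_{H̃G}}(H̃G))_ℚ`» for the fixed choice of
Green's current. [cite: RapoportSmithlingZhang2020Diagonal, §8.1 (8.3) (p. 44)] -/
def zHat (m : D.Pl → ℕ) : D.ChHat m := D.zHatOf (D.gz m)

/-- (8.2) (p. 44): «We extend this from a symmetric pairing to a hermitian pairing on the corresponding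
`ℂ`-vector space» — hermitian symmetry of `( , )_GS`. [cite: RapoportSmithlingZhang2020Diagonal, §8.1 (8.2) (p. 44)] -/
def RSZ2020_8_Eq82_hermitian : Prop :=
  ∀ x y : D.ChHat 0, D.gs y x = (starRingEnd ℂ) (D.gs x y)

/-- (8.5) (p. 44): «`Int♮(f) := (R̂(f) ẑ_{K°}, ẑ_{K°})_GS`». [cite: RapoportSmithlingZhang2020Diagonal, §8.1 (8.5) (p. 44)] -/
def IntNat0 (f : D.TestFnUf) : ℂ := D.gs (D.Rhat 0 f (D.zHat 0)) (D.zHat 0)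

/-- (8.5) (p. 44): «`Int(f) := 1/(τ(Z^ℚ)·[E:F]) · Int♮(f)`». [cite: RapoportSmithlingZhang2020Diagonal, §8.1 (8.5) (p. 44)] -/
def Int0 (f : D.TestFnUf) : ℂ := 1 / ((D.tauZQ : ℂ) * (D.degEF : ℂ)) * D.IntNat0 f

/-- The posited extension of `J` to `C_c^∞(G′(𝔸_{F₀}))` agrees with (7.9) on pure tensors: `J(f′) = J(f′, 0)`
(p. 44 «`J(f′_corr)`» with §7.2). [cite: RapoportSmithlingZhang2020Diagonal, §8.1 (p. 44)] -/
def RSZ2020_8_Jc_toCc : Prop := ∀ f' : D.TestFn, D.Jc (D.toCc f') = D.J₀ f'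

/-- The identity displayed in statement 8.2 of the source (p. 44), bare, as a predicate on `(f, f′, f′_corr)`: «`Int(f) =
−∂J(f′) − J(f′_corr)`» (`Int` of (8.5), `∂J` of (7.10), `J` of (7.9) on `C_c^∞(G′(𝔸_{F₀}))`); asserted nowhere.
[cite: RapoportSmithlingZhang2020Diagonal, Conj. 8.2 (p. 44)] -/
def RSZ2020_8_2_identity (f : D.TestFnUf) (f' : D.TestFn) (fcorr : D.CcG) : Prop :=
  D.Int0 f = -D.dJ f' - D.Jc fcorr

/-- **Statement 8.2 of the source AS A PREDICATE on `f`** (p. 44; «Global conj., trivial level structure» —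
ASSERTED, NOT PROVED, in the source; typed only because §8's theorems refer to these statements; asserted nowhere
in this file): «Let `f = ⊗_p f_p ∈ ℋ^{spl,Φ}_{K°}`, and let `f′ = ⊗_v f′_v ∈ ℋ(G′(𝔸_{F₀}))` be a Gaussian test
function such that `⊗_{v<∞} f′_v` is a smooth transfer of `f`. Then `Int(f) = −∂J(f′) − J(f′_corr)`, where `f′_corr
∈ C_c^∞(G′(𝔸_{F₀}))` is a correction function. Furthermore, we may choose `f′` such that `f′_corr = 0`» (second
clause GUARDED, READING R8d).  Remark 8.3 (p. 45): independent of the choices of transfer factors and Haar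
measures, by (7.14). [cite: RapoportSmithlingZhang2020Diagonal, Conj. 8.2 (p. 44)] -/
def RSZ2020_8_2_statement (f : D.TestFnUf) : Prop :=
  D.IsSpecialPure 0 f →
    (∀ f' : D.TestFn, D.IsGaussian f' → D.FinitePartSmoothTransfer f f' →
      ∃ fcorr : D.CcG, D.RSZ2020_8_2_identity f f' fcorr) ∧
    ((∃ f' : D.TestFn, D.IsGaussian f' ∧ D.FinitePartSmoothTransfer f f') →
      ∃ f' : D.TestFn, D.IsGaussian f' ∧ D.FinitePartSmoothTransfer f f' ∧ D.Int0 f = -D.dJ f')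

/-! ## §8.2 (pp. 45–50): non-trivial level structure -/

/-- **Definition 8.4, local** (p. 45): «Let `ν` be a non-archimedean place of `F₀`, of residue characteristic `ℓ`.
Let `f_ℓ ∈ C_c^∞(H̃G(ℚ_ℓ))` be completely decomposed, i.e., `f_ℓ = φ_ℓ ⊗ ⊗_{v∣ℓ} f_v`, cf. Definition 7.7. Then `f_ℓ`
is said to have regular support at `ν` if `supp f_ν ⊂ G_W(F_{0,ν})_rs`.» [cite: RapoportSmithlingZhang2020Diagonal, Def. 8.4 (p. 45)] -/
def HasRegularSupportUAt {ℓ : Nat.Primes} (fl : D.TestFnU ℓ) (ν : D.Pl) : Prop :=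
  ∃ (h : D.Over ν ℓ) (φ : D.TestFnZ ℓ) (fv : (v : D.Pl) → D.Over v ℓ → D.TestFnGW v),
    fl = D.tensorAt ℓ φ fv ∧ D.SuppRegularGW ν (fv ν h)

/-- **Definition 8.4, global** (p. 45): «If `f = ⊗_p f_p ∈ ℋ^{spl,Φ}_{K^m}` is a completely decomposed pure
tensor, then `f` has regular support at `ν` if `f_ℓ` has regular support at `ν`» (`ℓ` below `ν`).
[cite: RapoportSmithlingZhang2020Diagonal, Def. 8.4 (p. 45)] -/
def HasRegularSupportU (f : D.TestFnUf) (ν : D.Pl) : Prop :=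
  ∃ ℓ : Nat.Primes, D.HasRegularSupportUAt (D.compU f ℓ) ν

/-- **Theorem 8.5** (pp. 45–46): «Let `f = ⊗_p f_p ∈ ℋ^{spl,Φ}_{K^m}` be a completely decomposed pure tensor.
Assume that `f` has regular support at some place `ν` of `F₀`. Then the following statements on the support of the
intersection of the cycles `z_{K^m}` and `R(f) z_{K^m}` of `M_{K^m_{H̃G}}(H̃G)` hold. (i) The support does not meet
the generic fiber. (ii) Let `ν` be a place of `E` lying over a place of `F₀` which splits in `F`. Then the support
does not meet the special fiber `M_{K^m_{H̃G}}(H̃G) ⊗_{O_E} κ̄_ν`. (iii) Let `ν` be a place of `E` lying over a place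
of `F₀` which does not split in `F`. Then the support meets the special fiber … only in its basic locus.»  (Remark
8.6, p. 46 — `F₀ = ℚ`, non-compact: the closure of the support in the toroidal compactification misses the
boundary — is not typed.) [cite: RapoportSmithlingZhang2020Diagonal, Thm. 8.5 (p. 45)] -/
def RSZ2020_8_5_support : Prop :=
  ∀ (m : D.Pl → ℕ) (f : D.TestFnUf), D.IsLevelFn m → D.IsSpecialPure m f →
    (∃ ν : D.Pl, D.HasRegularSupportU f ν) →
      (∀ x ∈ D.suppInt m f, ¬ D.InGenericFibre x) ∧
      (∀ ν : D.PlE, ¬ D.IsArchE ν → D.IsSplit (D.below ν) →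
        ∀ x ∈ D.suppInt m f, ¬ D.InSpecialFibreAt x ν) ∧
      (∀ ν : D.PlE, ¬ D.IsArchE ν → ¬ D.IsSplit (D.below ν) →
        ∀ x ∈ D.suppInt m f, D.InSpecialFibreAt x ν → D.InBasicLocusAt x ν)

/-- **Lemma 8.7** (p. 46): «Let `k` be an algebraically closed field which is an `O_E`-algebra. Let `(A₀, ι₀)` be
an abelian variety with `O_F`-action with Kottwitz condition of signature `((0, 1)_{φ∈Φ})`, cf. (3.8), and let `(A,
ι)` be an abelian variety with `O_F`-action with Kottwitz condition of type `r` as in Remark 3.6 (i). Assume there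
exists an `F`-linear isogeny `A₀ⁿ → A`. Then `k` is of positive characteristic `p`. Let `ν` be the corresponding
place of `E`. The place `v₀` of `F₀` induced by `ν` is non-split in `F`, and the isogeny classes of `A₀` and `A`
only depend on the CM type `Φ` (READING R8c). If `v₀` is the only place of `F₀` above `p`, then `A₀` and `A` are
supersingular.»  The characteristic-zero step of the printed proof («such an isomorphism cannot exist due to the
different Kottwitz conditions on `A₀ⁿ` and `A`») is PROVED over `ℂ` in the tree: ★
`ComplexMultiplication.EndomorphismFieldBanalSignature.not_exists_isIsogeny_equivariant_of_banal_of_not_banal` (CITED,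
not restated). [cite: RapoportSmithlingZhang2020Diagonal, Lemma 8.7 (p. 46)] -/
def RSZ2020_8_7_no_isogeny : Prop :=
  ∀ (k : D.KFld) (A₀ : D.AV0 k) (A : D.AVr k), D.HasFLinearIsogenyPow A₀ A →
    (∃ p : Nat.Primes, D.charK k = p) ∧
    ∀ ν : D.PlE, D.placeK k ν →
      ¬ D.IsSplit (D.below ν) ∧
      (∀ (A₀' : D.AV0 k) (A' : D.AVr k), D.HasFLinearIsogenyPow A₀' A' → D.Isog0 A₀ A₀' ∧ D.IsogR A A') ∧
      ((∀ (p : Nat.Primes) (v : D.Pl), D.charK k = p → D.Over v p → v = D.below ν) →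
        D.IsSupersingular0 A₀ ∧ D.IsSupersingularR A)

/-- (8.12) (p. 48), for `f ∈ ℋ^{spl,Φ}_{K^m}` completely decomposed with regular support at some place (so that, by
Theorem 8.5 (i), the generic fibres of `z_{K^m}` and `R(f) z_{K^m}` do not meet): «`Int♮_ν(f) := ⟨R̂(f) ẑ_{K^m},
ẑ_{K^m}⟩_ν log q_ν`»; the same formula is (8.18) ∕ (8.19) (p. 50) on the bigger algebra `ℋ^p_K`.
[cite: RapoportSmithlingZhang2020Diagonal, §8.2 (8.12) (p. 48)] -/
def IntNatAt (m : D.Pl → ℕ) (f : D.TestFnUf) (ν : D.PlE) : ℂ :=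
  D.locPair m ν (D.Rhat m f (D.zHat m)) (D.zHat m) * (D.logq ν : ℂ)

/-- (8.12) (p. 48): «`Int(f) := 1/(τ(Z^ℚ)[E:F]) Σ_ν Int♮_ν(f)`» (sum over the places `ν` of `E`, finitely many
terms non-zero: `finsum`). [cite: RapoportSmithlingZhang2020Diagonal, §8.2 (8.12) (p. 48)] -/
def IntGlobal (m : D.Pl → ℕ) (f : D.TestFnUf) : ℂ :=
  1 / ((D.tauZQ : ℂ) * (D.degEF : ℂ)) * ∑ᶠ ν : D.PlE, D.IntNatAt m f ν

/-- The identity displayed in statement 8.8 of the source (p. 48), bare, as a predicate on `(m, f, f′, f′_corr)`: «`Int(f)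
= −∂J(f′) − J(f′_corr)`» (`Int` of (8.12) for the level `K^m`); asserted nowhere.
[cite: RapoportSmithlingZhang2020Diagonal, Conj. 8.8 (p. 48)] -/
def RSZ2020_8_8_identity (m : D.Pl → ℕ) (f : D.TestFnUf) (f' : D.TestFn) (fcorr : D.CcG) : Prop :=
  D.IntGlobal m f = -D.dJ f' - D.Jc fcorr

/-- **Statement 8.8 of the source AS A PREDICATE on `(m, f)`** (p. 48; «Global conj., nontrivial level structure»
— ASSERTED, NOT PROVED, in the source; it is the conclusion of the proved Theorem 8.14; asserted nowhere in this
file): «Let `f = ⊗_p f_p ∈ ℋ^{spl,Φ}_{K^m}` be a completely decomposed pure tensor and let `f′ = ⊗_v f′_v ∈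
ℋ(G′(𝔸))` be a Gaussian test function such that `⊗_{v<∞} f′_v` is a smooth transfer of `f`. Assume that `f` has
regular support at some place `ν` of `F₀`. Then `Int(f) = −∂J(f′) − J(f′_corr)`, where `f′_corr ∈ C_c^∞(G′(𝔸))` is
a correction function. Furthermore, `f′ = ⊗_v f′_v` may be chosen such that `f′` has regular support at `ν` and that
`f′_corr = 0`» (second clause GUARDED, READING R8d).  Remarks 8.9–8.10 (p. 48; Green's current vs. correction
function; relation to `L′` via (7.6)) are prose. [cite: RapoportSmithlingZhang2020Diagonal, Conj. 8.8 (p. 48)] -/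
def RSZ2020_8_8_statement (m : D.Pl → ℕ) (f : D.TestFnUf) : Prop :=
  ∀ ν : D.Pl, D.IsLevelFn m → D.IsSpecialPure m f → D.HasRegularSupportU f ν →
    (∀ f' : D.TestFn, D.IsGaussian f' → D.FinitePartSmoothTransfer f f' →
      ∃ fcorr : D.CcG, D.RSZ2020_8_8_identity m f f' fcorr) ∧
    ((∃ f' : D.TestFn, D.IsGaussian f' ∧ D.FinitePartSmoothTransfer f f') →
      ∃ f' : D.TestFn, D.IsGaussian f' ∧ D.FinitePartSmoothTransfer f f' ∧ D.HasRegularSupportAt f' ν ∧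
        D.IntGlobal m f = -D.dJ f')

/-- **Lemma 8.11** (pp. 48–49): «(i) Let `u ∈ supp m` be a place above `p` (in particular `u` is split in `F`).
There exists a non-zero function `f_p ∈ ℋ_{K^m_{H̃G},p}` that has regular support at `u`. (ii) For any `f_p ∈
ℋ_{K^m_{H̃G},p}` with regular support at the place `u` above `p`, there exists a transfer `(f′_v)_{v∣p}` such that
`f′_u` has regular support at `u`» (transfer: Definition 7.6; regular support of `f′_u`: Definition 7.5).
[cite: RapoportSmithlingZhang2020Diagonal, Lemma 8.11 (p. 48)] -/
def RSZ2020_8_11_regular_transfer : Prop :=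
  ∀ (m : D.Pl → ℕ) (p : Nat.Primes) (u : D.Pl), D.IsLevelFn m → u ∈ Function.support m → D.Over u p →
    (∃ fp : D.TestFnU p, D.InHkp m p fp ∧ fp ≠ D.zeroU p ∧ D.HasRegularSupportUAt fp u) ∧
    (∀ fp : D.TestFnU p, D.InHkp m p fp → D.HasRegularSupportUAt fp u →
      ∃ f' : (v : D.Pl) → D.Over v p → D.TestFnLoc v,
        D.AreTransfersAt p fp f' ∧ ∀ h : D.Over u p, D.SuppRegular u (f' u h))

/-- (8.15) (p. 49): «`Int_v(f) := 1/(τ(Z^ℚ)·[E:F]) Σ_{ν∣v} Int♮_ν(f)`»; verbatim also (8.18) (p. 50, `v₀`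
non-archimedean, `f ∈ ℋ^p_K`) and (8.19) (p. 50, `v₀` archimedean) — the posited `R̂`, `⟨ , ⟩_ν` are total, so one
definition serves. [cite: RapoportSmithlingZhang2020Diagonal, §8.2 (8.15) (p. 49)] -/
def IntAt (m : D.Pl → ℕ) (f : D.TestFnUf) (v : D.Pl) : ℂ :=
  1 / ((D.tauZQ : ℂ) * (D.degEF : ℂ)) * ∑ᶠ (ν : D.PlE) (_ : D.below ν = v), D.IntNatAt m f ν

/-- (8.14)–(8.15) (p. 49), for `f` as in (8.12): «The left-hand side of (8.12) can be localized, i.e., we can write it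
as a sum [over the places `v` of `F₀`], `Int(f) = Σ_v Int_v(f)`» (READING R8a: typed over all places `v`; the
lead-in says «non-archimedean»), with the finiteness that makes (8.12), (8.14) and the inner sums `Σ_{ν∣v}` of (8.15) ∕
(8.18) ∕ (8.19) honest finite sums (`finsum`): finitely many places `ν` of `E` lie over a place `v` of `F₀`, and
finitely many `Int♮_ν(f)` are non-zero. [cite: RapoportSmithlingZhang2020Diagonal, §8.2 (8.14)–(8.15) (p. 49)] -/
def RSZ2020_8_Eq814_localization : Prop :=
  (∀ v : D.Pl, {ν : D.PlE | D.below ν = v}.Finite) ∧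
  ∀ (m : D.Pl → ℕ) (f : D.TestFnUf), D.IsLevelFn m → D.IsSpecialPure m f →
    (∃ ν : D.Pl, D.HasRegularSupportU f ν) →
      {ν : D.PlE | D.IntNatAt m f ν ≠ 0}.Finite ∧ D.IntGlobal m f = ∑ᶠ v : D.Pl, D.IntAt m f v

/-- **Proposition 8.12** (pp. 49–50): «In the situation of [statement] 8.8 [with `f′` chosen, by Lemma 8.11, with
regular support at `ν`], let `v₀` be a place of `F₀` that is split in `F`. Then `Int_{v₀}(f) = ∂J_{v₀}(f′) = 0`»
(by Lemma 7.12 and Theorem 8.5 (ii)). [cite: RapoportSmithlingZhang2020Diagonal, Prop. 8.12 (p. 49)] -/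
def RSZ2020_8_12_split_vanishing : Prop :=
  ∀ (m : D.Pl → ℕ) (f : D.TestFnUf) (f' : D.TestFn) (ν v₀ : D.Pl), D.IsLevelFn m → D.IsSpecialPure m f →
    D.IsGaussian f' → D.FinitePartSmoothTransfer f f' → D.HasRegularSupportU f ν → D.HasRegularSupportAt f' ν →
    D.IsSplit v₀ → D.IntAt m f v₀ = 0 ∧ D.dJv f' v₀ = 0

/-! ## §8.3 (pp. 50–54): the semi-global statements -/

/-- The common hypotheses of statement 8.13 (p. 50) at the place `v₀` (non-split in `F`, §8.3 «from now on»), for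
the level `K^m` (READING R8b): «Let `f = ⊗_ℓ f_ℓ ∈ ℋ^p_K` (`ℋ_K` if `p` is archimedean) be completely decomposed,
and let `f′ = ⊗_v f′_v ∈ ℋ(G′(𝔸_{F₀}))` be a Gaussian test function such that `⊗_{v<∞} f′_v` is a smooth transfer
of `f`. Assume that for some `ℓ` prime to `v₀` and some place `ν` above `ℓ`, the function `f` has regular support at
`ν` in the sense of Definition 8.4 and that `f′` has regular support at `ν` in the sense of Definition 7.5.»
[cite: RapoportSmithlingZhang2020Diagonal, Conj. 8.13 (p. 50)] -/
def SemiGlobalHyp (m : D.Pl → ℕ) (v₀ : D.Pl) (f : D.TestFnUf) (f' : D.TestFn) : Prop :=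
  D.IsLevelFn m ∧ ¬ D.IsSplit v₀ ∧
    (D.IsArch v₀ → ∀ ℓ : Nat.Primes, D.InHkp m ℓ (D.compU f ℓ) ∧ D.IsCompletelyDecomposed (D.compU f ℓ)) ∧
    (∀ p : Nat.Primes, D.Over v₀ p → D.IsPurePrimeTo m p f) ∧
    D.IsGaussian f' ∧ D.FinitePartSmoothTransfer f f' ∧
    ∃ (ℓ : Nat.Primes) (ν : D.Pl), ¬ D.Over v₀ ℓ ∧ D.Over ν ℓ ∧ D.HasRegularSupportU f ν ∧ D.HasRegularSupportAt f' ν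

/-- The correction-free identity displayed in statement 8.13 of the source (p. 50 (i); p. 51 (ii) «Furthermore»), bare,
as a predicate on `(m, v₀, f, f′)`: «`Int_{v₀}(f) = −∂J_{v₀}(f′)`» (`Int_{v₀}` of (8.15) ∕ (8.18) ∕ (8.19), `∂J_{v₀}` of
(7.10)); asserted nowhere. [cite: RapoportSmithlingZhang2020Diagonal, Conj. 8.13 (p. 50)] -/
def RSZ2020_8_13_identity (m : D.Pl → ℕ) (v₀ : D.Pl) (f : D.TestFnUf) (f' : D.TestFn) : Prop :=
  D.IntAt m f v₀ = -D.dJv f' v₀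

/-- **Statement 8.13 (i) of the source AS A PREDICATE on `(m, v₀, f, f′)`** (p. 50; «Semi-global conj.» —
ASSERTED in general, PROVED for `n ≤ 3` (Theorem 8.15); asserted nowhere in this file): under `SemiGlobalHyp`,
«(i) Assume that `v₀` is non-archimedean of hyperspecial type, cf. Section 4.1, and that `f′_{v₀} =
1_{G′(O_{F₀,v₀})}`. Then `Int_{v₀}(f) = −∂J_{v₀}(f′)`.» [cite: RapoportSmithlingZhang2020Diagonal, Conj. 8.13 (p. 50)] -/
def RSZ2020_8_13_i_statement (m : D.Pl → ℕ) (v₀ : D.Pl) (f : D.TestFnUf) (f' : D.TestFn) : Prop :=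
  D.SemiGlobalHyp m v₀ f f' → ¬ D.IsArch v₀ → D.IsHyperspecialType v₀ → D.comp f' v₀ = D.oneGO v₀ →
    D.RSZ2020_8_13_identity m v₀ f f'

/-- **Statement 8.13 (ii) of the source AS A PREDICATE on `(m, v₀, f, f′)`** (p. 51; ASSERTED in general, PROVED
for `n ≤ 3` and `v₀` non-archimedean (Theorem 8.19); asserted nowhere in this file): under `SemiGlobalHyp`, «(ii)
Assume that `v₀` is archimedean, or non-archimedean of AT type, cf. Section 4.4. Then `Int_{v₀}(f) = −∂J_{v₀}(f′)
− J(f′_corr[v₀])`, where `f′_corr[v₀] = ⊗_v f′_{corr,v}`, with `f′_{corr,v} = f′_v` for `v ≠ v₀`, is a correction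
function. Furthermore, `f′` may be chosen such that `f′_corr[v₀]` is zero» (second clause GUARDED, READING R8d).
[cite: RapoportSmithlingZhang2020Diagonal, Conj. 8.13 (p. 50)] -/
def RSZ2020_8_13_ii_statement (m : D.Pl → ℕ) (v₀ : D.Pl) (f : D.TestFnUf) (f' : D.TestFn) : Prop :=
  (D.IsArch v₀ ∨ D.IsATType v₀) →
    (D.SemiGlobalHyp m v₀ f f' →
      ∃ fc : D.TestFn, (∀ v : D.Pl, v ≠ v₀ → D.comp fc v = D.comp f' v) ∧
        D.IntAt m f v₀ = -D.dJv f' v₀ - D.J₀ fc) ∧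
    ((∃ f'' : D.TestFn, D.SemiGlobalHyp m v₀ f f'') →
      ∃ f'' : D.TestFn, D.SemiGlobalHyp m v₀ f f'' ∧ D.RSZ2020_8_13_identity m v₀ f f'')

/-- **Theorem 8.14** (p. 51): «The semi-global conj. [statement] 8.13 for all places `v₀` implies the global conj.
[statement] 8.8» (for each level `K^m`; via (7.12), (8.14), Proposition 8.12 and (8.17); «conj.» abbreviates the
source's word, see the module docstring).
[cite: RapoportSmithlingZhang2020Diagonal, Thm. 8.14 (p. 51)] -/
def RSZ2020_8_14_semiglobal_implies_global : Prop :=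
  ∀ m : D.Pl → ℕ, D.IsLevelFn m →
    (∀ (v₀ : D.Pl) (f : D.TestFnUf) (f' : D.TestFn),
        D.RSZ2020_8_13_i_statement m v₀ f f' ∧ D.RSZ2020_8_13_ii_statement m v₀ f f') →
      ∀ f : D.TestFnUf, D.RSZ2020_8_8_statement m f

/-- **Theorem 8.15** (pp. 51–53): «[Statement] 8.13 (i) holds when `n ≤ 3`» (proved from the AFL, known for `n ≤
3` ([55, Th. 5.5], [36]), via (8.20)–(8.29) and Lemma 8.16). [cite: RapoportSmithlingZhang2020Diagonal, Thm. 8.15 (p. 51)] -/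
def RSZ2020_8_15_hyperspecial_n_le_3 : Prop :=
  D.n ≤ 3 → ∀ (m : D.Pl → ℕ) (v₀ : D.Pl) (f : D.TestFnUf) (f' : D.TestFn), D.RSZ2020_8_13_i_statement m v₀ f f'

/-- **Lemma 8.16** (p. 53): for the banal local data `(L₀, L, Φ_L, r_L, 𝕏₀, 𝕏, …)` as printed, «`N_{Φ̄_L,r_L} ≃
G(L₀)/K`, where `G` is the unitary group of an `L/L₀`-hermitian vector space of invariant `inv^{r_L}(𝕏₀, 𝕏)`, and
where `K` is the stabilizer of a vertex lattice of type `t := log_q |ker λ_𝕏|`» — `N` being formally étale over `Spf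
O_{Ĕ′}` (proof, Lemmas B.1 and B.4), the isomorphism is the identification of its point set with `G(L₀)/K`.
(Remarks 8.17, 8.18, p. 53–54, are not typed.) [cite: RapoportSmithlingZhang2020Diagonal, Lemma 8.16 (p. 53)] -/
def RSZ2020_8_16_banal_RZ_space : Prop :=
  ∀ d : D.Banal, D.NFormallyEtale d ∧ Nonempty (D.NPts d ≃ D.GmodK d)

/-- **Theorem 8.19** (p. 54): «[Statement] 8.13 (ii) holds when `n ≤ 3` and `v₀` is non-archimedean» (from the
AT conj. proved for `n ≤ 3` in [42], [43], with the AT identity (8.30); Remark 8.20 on the factor `2`).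
[cite: RapoportSmithlingZhang2020Diagonal, Thm. 8.19 (p. 54)] -/
def RSZ2020_8_19_AT_n_le_3 : Prop :=
  D.n ≤ 3 → ∀ (m : D.Pl → ℕ) (v₀ : D.Pl) (f : D.TestFnUf) (f' : D.TestFn), ¬ D.IsArch v₀ →
    D.RSZ2020_8_13_ii_statement m v₀ f f'

/-- The printed laws of §8 together (the PROVED statements and the definitional compatibilities; the predicates
typing the source's unproved statements 8.2, 8.8, 8.13 are deliberately NOT conjuncts).
[cite: RapoportSmithlingZhang2020Diagonal, §8 (pp. 43–54)] -/
def PrintedLaws8 : Prop :=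
  D.RSZ2020_8_Eq82_hermitian ∧ D.RSZ2020_8_Jc_toCc ∧ D.RSZ2020_8_5_support ∧ D.RSZ2020_8_7_no_isogeny ∧
    D.RSZ2020_8_11_regular_transfer ∧ D.RSZ2020_8_Eq814_localization ∧ D.RSZ2020_8_12_split_vanishing ∧
    D.RSZ2020_8_14_semiglobal_implies_global ∧ D.RSZ2020_8_15_hyperspecial_n_le_3 ∧
    D.RSZ2020_8_16_banal_RZ_space ∧ D.RSZ2020_8_19_AT_n_le_3

end Sec8Data

end Literature.AlgebraicGeometry.ShimuraVarieties.RapoportSmithlingZhang2020.Sec8ArithmeticIntersectionPairing
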